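import Literature.Computability.AlgebraicComplexity.FlipGraph222OrbitCanon
import Literature.Computability.AlgebraicComplexity.FlipGraph222StdComponent
import Literature.Computability.AlgebraicComplexity.FlipGraph222StdComponentCanon1
import Literature.Computability.AlgebraicComplexity.FlipGraph222StdComponentCanon2
import HarnessLib

/-!
# The component of the standard algorithm has exactly `273` vertices — key replay 3/3 and the count (`(2,2,2)`, `ℤ₂`; KM 2023 §4)

Topic `Literature/Computability/AlgebraicComplexity`. Source: M. Kauers, J. Moosbauer, *Flip Graphs
for Matrix Multiplication*, ISSAC 2023 = arXiv:2212.01175 (KM), §4 / Fig. 1: the connected component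
of the standard algorithm in the `(2,2,2)`-flip graph of rank at most `8` over `ℤ₂` "has `272`
vertices, each representing the orbit of one multiplication scheme".

## What is typed (everything PROVED, kernel replay; no definitions, no named facts)

`FlipGraph222StdComponent.lean` lists `273` code lists `Comp222.creps` whose orbits ARE the component
of the standard algorithm (`Comp222.kauersMoosbauer2023_fig1_component_eq`), and
`FlipGraph222OrbitCanon.lean` provides a `G`-invariant key `Canon222.canonKey` of well-formed code
lists together with the table `Canon222.canonTab` of the `273` keys reduced modulo the prime
`Canon222.keyMod = 2⁶¹ − 1`, pairwise distinct (`Canon222.canonTab_nodup`). This file replays, in the kernel,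
`canonKey creps[i] % keyMod = canonTab[i]` for the representatives `192 ≤ i < 273` (chunks of `6`,
`decide +kernel`; `FlipGraph222StdComponentCanon1/2.lean` cover `i < 192`) and CONCLUDES: equal
vertices `cv i = cv j` would be equivalent schemes `cs i ≈ cs j`, hence equal keys
(`Canon222.canonKey_eq_of_equiv`), hence `i = j` — the `273` listed orbits are pairwise distinct
(`cv_injective`), so **the component of the standard algorithm in KM's flip graph of rank at most `8`
for `(2,2,2)` over `ℤ₂` has exactly `273` vertices** (`kauersMoosbauer2023_fig1_component_card`),
and every vertex of it is the orbit of exactly one listed scheme (`reachable_iff_existsUnique`).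
KM print "`272` vertices" (= their published vertex data, which lack the orbit of `creps[269]`, one
of the seven forward-unreachable orbits of `FlipGraph222HiddenOrbits.lean`); the edge count `1183`
and the `7` reductions are not addressed here.

HONEST FRAMING: a statement about `⟨2,2,2⟩` over `ℤ₂` and the weak component (Def. 8 / Thm. 9:
flips and reductions traversed in either direction) of the standard algorithm in the rank-`≤ 8`
graph, whose vertices are orbits under KM's group `G` (`InSymmetryGroup`: sandwiches, cyclic shift,
transposition). Nothing about other fields or formats.

## References

* M. Kauers, J. Moosbauer, *Flip Graphs for Matrix Multiplication*, ISSAC 2023, 381–388,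
  doi:10.1145/3597066.3597120, arXiv:2212.01175: §2 (equivalence = same orbit), Def. 8, Thm. 9,
  §4 and Fig. 1 ("It has 272 vertices"). [KauersMoosbauer2022FlipGraphs]
-/

set_option Elab.async false

namespace Literature.Computability.AlgebraicComplexity

namespace FlipGraph

namespace Comp222

open Cert222 StdBall222 Hidden222 Canon222

/-- Key replay, chunk 32 (representatives `192 ≤ i < 198`): the canonical key of `creps[i]`,
reduced modulo `keyMod`, is `canonTab[i]` (kernel evaluation). [cite: KauersMoosbauer2022FlipGraphs, §4 ("It has 272 vertices"), §2 (equivalence = same orbit)] -/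
theorem canonOk_32 : ((List.range' 192 6).all fun i =>
    canonKey (creps.getD i []) % keyMod == canonTab.getD i 0) = true := by
  decide +kernel

/-- Key replay, chunk 33 (representatives `198 ≤ i < 204`): the canonical key of `creps[i]`,
reduced modulo `keyMod`, is `canonTab[i]` (kernel evaluation). [cite: KauersMoosbauer2022FlipGraphs, §4 ("It has 272 vertices"), §2 (equivalence = same orbit)] -/
theorem canonOk_33 : ((List.range' 198 6).all fun i =>
    canonKey (creps.getD i []) % keyMod == canonTab.getD i 0) = true := by
  decide +kernel

/-- Key replay, chunk 34 (representatives `204 ≤ i < 210`): the canonical key of `creps[i]`,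
reduced modulo `keyMod`, is `canonTab[i]` (kernel evaluation). [cite: KauersMoosbauer2022FlipGraphs, §4 ("It has 272 vertices"), §2 (equivalence = same orbit)] -/
theorem canonOk_34 : ((List.range' 204 6).all fun i =>
    canonKey (creps.getD i []) % keyMod == canonTab.getD i 0) = true := by
  decide +kernel

/-- Key replay, chunk 35 (representatives `210 ≤ i < 216`): the canonical key of `creps[i]`,
reduced modulo `keyMod`, is `canonTab[i]` (kernel evaluation). [cite: KauersMoosbauer2022FlipGraphs, §4 ("It has 272 vertices"), §2 (equivalence = same orbit)] -/
theorem canonOk_35 : ((List.range' 210 6).all fun i =>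
    canonKey (creps.getD i []) % keyMod == canonTab.getD i 0) = true := by
  decide +kernel

/-- Key replay, chunk 36 (representatives `216 ≤ i < 222`): the canonical key of `creps[i]`,
reduced modulo `keyMod`, is `canonTab[i]` (kernel evaluation). [cite: KauersMoosbauer2022FlipGraphs, §4 ("It has 272 vertices"), §2 (equivalence = same orbit)] -/
theorem canonOk_36 : ((List.range' 216 6).all fun i =>
    canonKey (creps.getD i []) % keyMod == canonTab.getD i 0) = true := by
  decide +kernel

/-- Key replay, chunk 37 (representatives `222 ≤ i < 228`): the canonical key of `creps[i]`,
reduced modulo `keyMod`, is `canonTab[i]` (kernel evaluation). [cite: KauersMoosbauer2022FlipGraphs, §4 ("It has 272 vertices"), §2 (equivalence = same orbit)] -/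
theorem canonOk_37 : ((List.range' 222 6).all fun i =>
    canonKey (creps.getD i []) % keyMod == canonTab.getD i 0) = true := by
  decide +kernel

/-- Key replay, chunk 38 (representatives `228 ≤ i < 234`): the canonical key of `creps[i]`,
reduced modulo `keyMod`, is `canonTab[i]` (kernel evaluation). [cite: KauersMoosbauer2022FlipGraphs, §4 ("It has 272 vertices"), §2 (equivalence = same orbit)] -/
theorem canonOk_38 : ((List.range' 228 6).all fun i =>
    canonKey (creps.getD i []) % keyMod == canonTab.getD i 0) = true := by
  decide +kernel

/-- Key replay, chunk 39 (representatives `234 ≤ i < 240`): the canonical key of `creps[i]`,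
reduced modulo `keyMod`, is `canonTab[i]` (kernel evaluation). [cite: KauersMoosbauer2022FlipGraphs, §4 ("It has 272 vertices"), §2 (equivalence = same orbit)] -/
theorem canonOk_39 : ((List.range' 234 6).all fun i =>
    canonKey (creps.getD i []) % keyMod == canonTab.getD i 0) = true := by
  decide +kernel

/-- Key replay, chunk 40 (representatives `240 ≤ i < 246`): the canonical key of `creps[i]`,
reduced modulo `keyMod`, is `canonTab[i]` (kernel evaluation). [cite: KauersMoosbauer2022FlipGraphs, §4 ("It has 272 vertices"), §2 (equivalence = same orbit)] -/
theorem canonOk_40 : ((List.range' 240 6).all fun i =>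
    canonKey (creps.getD i []) % keyMod == canonTab.getD i 0) = true := by
  decide +kernel

/-- Key replay, chunk 41 (representatives `246 ≤ i < 252`): the canonical key of `creps[i]`,
reduced modulo `keyMod`, is `canonTab[i]` (kernel evaluation). [cite: KauersMoosbauer2022FlipGraphs, §4 ("It has 272 vertices"), §2 (equivalence = same orbit)] -/
theorem canonOk_41 : ((List.range' 246 6).all fun i =>
    canonKey (creps.getD i []) % keyMod == canonTab.getD i 0) = true := by
  decide +kernel

/-- Key replay, chunk 42 (representatives `252 ≤ i < 258`): the canonical key of `creps[i]`,
reduced modulo `keyMod`, is `canonTab[i]` (kernel evaluation). [cite: KauersMoosbauer2022FlipGraphs, §4 ("It has 272 vertices"), §2 (equivalence = same orbit)] -/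
theorem canonOk_42 : ((List.range' 252 6).all fun i =>
    canonKey (creps.getD i []) % keyMod == canonTab.getD i 0) = true := by
  decide +kernel

/-- Key replay, chunk 43 (representatives `258 ≤ i < 264`): the canonical key of `creps[i]`,
reduced modulo `keyMod`, is `canonTab[i]` (kernel evaluation). [cite: KauersMoosbauer2022FlipGraphs, §4 ("It has 272 vertices"), §2 (equivalence = same orbit)] -/
theorem canonOk_43 : ((List.range' 258 6).all fun i =>
    canonKey (creps.getD i []) % keyMod == canonTab.getD i 0) = true := by
  decide +kernel

/-- Key replay, chunk 44 (representatives `264 ≤ i < 270`): the canonical key of `creps[i]`,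
reduced modulo `keyMod`, is `canonTab[i]` (kernel evaluation). [cite: KauersMoosbauer2022FlipGraphs, §4 ("It has 272 vertices"), §2 (equivalence = same orbit)] -/
theorem canonOk_44 : ((List.range' 264 6).all fun i =>
    canonKey (creps.getD i []) % keyMod == canonTab.getD i 0) = true := by
  decide +kernel

/-- Key replay, chunk 45 (representatives `270 ≤ i < 273`): the canonical key of `creps[i]`,
reduced modulo `keyMod`, is `canonTab[i]` (kernel evaluation). [cite: KauersMoosbauer2022FlipGraphs, §4 ("It has 272 vertices"), §2 (equivalence = same orbit)] -/
theorem canonOk_45 : ((List.range' 270 3).all fun i =>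
    canonKey (creps.getD i []) % keyMod == canonTab.getD i 0) = true := by
  decide +kernel

/-- Reading one entry of an `all` over a range (bookkeeping). [folklore] -/
private theorem all_range'_imp' {f : ℕ → Bool} {a n : ℕ} (h : ((List.range' a n).all f) = true)
    (i : ℕ) (h₁ : a ≤ i) (h₂ : i < a + n) : f i = true := by
  rw [List.all_eq_true] at h
  exact h i (List.mem_range'_1.mpr ⟨h₁, h₂⟩)

/-- **Key replay, all representatives:** `canonKey creps[i] % keyMod = canonTab[i]` for every
`i < 273` (the `46` kernel chunks of the three files). [cite: KauersMoosbauer2022FlipGraphs, §4 ("It has 272 vertices"), §2 (equivalence = same orbit)] -/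
theorem canonKey_creps (i : ℕ) (hi : i < 273) :
    canonKey (creps.getD i []) % keyMod = canonTab.getD i 0 := by
  refine beq_iff_eq.mp ?_
  by_cases h0 : i < 6
  · exact all_range'_imp' canonOk_0 i (by omega) (by omega)
  by_cases h1 : i < 12
  · exact all_range'_imp' canonOk_1 i (by omega) (by omega)
  by_cases h2 : i < 18
  · exact all_range'_imp' canonOk_2 i (by omega) (by omega)
  by_cases h3 : i < 24
  · exact all_range'_imp' canonOk_3 i (by omega) (by omega)
  by_cases h4 : i < 30
  · exact all_range'_imp' canonOk_4 i (by omega) (by omega)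
  by_cases h5 : i < 36
  · exact all_range'_imp' canonOk_5 i (by omega) (by omega)
  by_cases h6 : i < 42
  · exact all_range'_imp' canonOk_6 i (by omega) (by omega)
  by_cases h7 : i < 48
  · exact all_range'_imp' canonOk_7 i (by omega) (by omega)
  by_cases h8 : i < 54
  · exact all_range'_imp' canonOk_8 i (by omega) (by omega)
  by_cases h9 : i < 60
  · exact all_range'_imp' canonOk_9 i (by omega) (by omega)
  by_cases h10 : i < 66
  · exact all_range'_imp' canonOk_10 i (by omega) (by omega)
  by_cases h11 : i < 72
  · exact all_range'_imp' canonOk_11 i (by omega) (by omega)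
  by_cases h12 : i < 78
  · exact all_range'_imp' canonOk_12 i (by omega) (by omega)
  by_cases h13 : i < 84
  · exact all_range'_imp' canonOk_13 i (by omega) (by omega)
  by_cases h14 : i < 90
  · exact all_range'_imp' canonOk_14 i (by omega) (by omega)
  by_cases h15 : i < 96
  · exact all_range'_imp' canonOk_15 i (by omega) (by omega)
  by_cases h16 : i < 102
  · exact all_range'_imp' canonOk_16 i (by omega) (by omega)
  by_cases h17 : i < 108
  · exact all_range'_imp' canonOk_17 i (by omega) (by omega)
  by_cases h18 : i < 114
  · exact all_range'_imp' canonOk_18 i (by omega) (by omega)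
  by_cases h19 : i < 120
  · exact all_range'_imp' canonOk_19 i (by omega) (by omega)
  by_cases h20 : i < 126
  · exact all_range'_imp' canonOk_20 i (by omega) (by omega)
  by_cases h21 : i < 132
  · exact all_range'_imp' canonOk_21 i (by omega) (by omega)
  by_cases h22 : i < 138
  · exact all_range'_imp' canonOk_22 i (by omega) (by omega)
  by_cases h23 : i < 144
  · exact all_range'_imp' canonOk_23 i (by omega) (by omega)
  by_cases h24 : i < 150
  · exact all_range'_imp' canonOk_24 i (by omega) (by omega)
  by_cases h25 : i < 156
  · exact all_range'_imp' canonOk_25 i (by omega) (by omega)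
  by_cases h26 : i < 162
  · exact all_range'_imp' canonOk_26 i (by omega) (by omega)
  by_cases h27 : i < 168
  · exact all_range'_imp' canonOk_27 i (by omega) (by omega)
  by_cases h28 : i < 174
  · exact all_range'_imp' canonOk_28 i (by omega) (by omega)
  by_cases h29 : i < 180
  · exact all_range'_imp' canonOk_29 i (by omega) (by omega)
  by_cases h30 : i < 186
  · exact all_range'_imp' canonOk_30 i (by omega) (by omega)
  by_cases h31 : i < 192
  · exact all_range'_imp' canonOk_31 i (by omega) (by omega)
  by_cases h32 : i < 198
  · exact all_range'_imp' canonOk_32 i (by omega) (by omega)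
  by_cases h33 : i < 204
  · exact all_range'_imp' canonOk_33 i (by omega) (by omega)
  by_cases h34 : i < 210
  · exact all_range'_imp' canonOk_34 i (by omega) (by omega)
  by_cases h35 : i < 216
  · exact all_range'_imp' canonOk_35 i (by omega) (by omega)
  by_cases h36 : i < 222
  · exact all_range'_imp' canonOk_36 i (by omega) (by omega)
  by_cases h37 : i < 228
  · exact all_range'_imp' canonOk_37 i (by omega) (by omega)
  by_cases h38 : i < 234
  · exact all_range'_imp' canonOk_38 i (by omega) (by omega)
  by_cases h39 : i < 240
  · exact all_range'_imp' canonOk_39 i (by omega) (by omega)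
  by_cases h40 : i < 246
  · exact all_range'_imp' canonOk_40 i (by omega) (by omega)
  by_cases h41 : i < 252
  · exact all_range'_imp' canonOk_41 i (by omega) (by omega)
  by_cases h42 : i < 258
  · exact all_range'_imp' canonOk_42 i (by omega) (by omega)
  by_cases h43 : i < 264
  · exact all_range'_imp' canonOk_43 i (by omega) (by omega)
  by_cases h44 : i < 270
  · exact all_range'_imp' canonOk_44 i (by omega) (by omega)
  exact all_range'_imp' canonOk_45 i (by omega) (by omega)

/-- The representatives are well-formed code lists (from the closure certificate). [cite: KauersMoosbauer2022FlipGraphs, Def. 1] -/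
theorem wfL_creps (i : Fin 273) : wfL (creps.getD i.val []) = true := by
  have h := closureB_all i.val i.isLt
  simp only [closureB, Bool.and_eq_true] at h
  exact h.1.1

/-- **The `273` listed orbits are pairwise distinct:** `i ↦ cv i` is injective (equal vertices are
equivalent schemes, which have equal canonical keys, whose reductions modulo `keyMod` are the
pairwise distinct entries of `canonTab`). [cite: KauersMoosbauer2022FlipGraphs, §2 (equivalence = same orbit), §4 (Fig. 1)] -/
theorem cv_injective : Function.Injective cv := by
  intro i j h
  have hq : Quotient.mk (orbitSetoidKM (ZMod 2) 2) (cs i) = Quotient.mk _ (cs j) :=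
    congrArg Subtype.val h
  have hr : (orbitSetoidKM (ZMod 2) 2).r (cs i) (cs j) := Quotient.exact hq
  have hk := canonKey_eq_of_equiv (wfL_creps i) (wfL_creps j) (cs_elts i) (cs_elts j) hr
  have hij : i.val = j.val :=
    canonTab_getD_inj i.isLt j.isLt (by rw [← canonKey_creps i.val i.isLt, ← canonKey_creps j.val j.isLt, hk])
  exact Fin.ext hij

/-- **KM §4 / Fig. 1, `(2,2,2)` over `ℤ₂`, the COUNT in the kernel:** the connected component of the
standard algorithm in KM's flip graph of rank at most `8` (vertices = orbits under the symmetry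
group `G`, Def. 8; components in the weak sense of Def. 8 / Thm. 9) has exactly `273` vertices.
KM print: "It has `272` vertices". [cite: KauersMoosbauer2022FlipGraphs, §4 ("It has 272 vertices"), Def. 8, Thm. 9] -/
theorem kauersMoosbauer2023_fig1_component_card :
    (flipGraph222LE8.connectedComponentMk vtxStd).supp.ncard = 273 := by
  rw [kauersMoosbauer2023_fig1_component_supp, Set.ncard_range_of_injective cv_injective,
    Nat.card_eq_fintype_card, Fintype.card_fin]

/-- Equivalently: a vertex lies in the component of the standard algorithm iff it is the orbit of
EXACTLY ONE of the `273` listed schemes. [cite: KauersMoosbauer2022FlipGraphs, §4 (Fig. 1), Def. 8] -/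
theorem reachable_iff_existsUnique (v : Vtx222LE8) :
    flipGraph222LE8.Reachable vtxStd v ↔ ∃! i : Fin 273, v = cv i := by
  rw [kauersMoosbauer2023_fig1_component_eq]
  constructor
  · rintro ⟨i, rfl⟩
    exact ⟨i, rfl, fun j hj => (cv_injective hj).symm⟩
  · rintro ⟨i, hi, -⟩
    exact ⟨i, hi⟩

end Comp222

end FlipGraph

end Literature.Computability.AlgebraicComplexity
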